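import Summits.HodgeConjecture.HodgeConjecture.Theses.RankFourFaces
import Literature.AlgebraicGeometry.Motives.AbelianVarietyProjectiveChart

/-!
# Crux `HodgeAbelianVarieties` (stmt-HodgeConjecture-1333) — the CM-pivot glue at FORMULA level (for `route edit --split … --glue-by`)

The BC2 redirect of the crux (`Cruxes/HodgeAbelianVarieties/BC2-REDIRECT-r1.md`, strategist r1) splits
`PadicSemiregularLift.HodgeAbelianVarieties := ∀ A : AbelianVariety ℂ, HodgeConjectureFor A.dim A.X` into the two existing
items `RankFourFaces.CMAbelianHodge` (stmt-HodgeConjecture-3052) and `RankFourFaces.CMToAbelian` (stmt-HodgeConjecture-16267).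
The glue is already PROVED in the tree against the route decl (`…CMPivotBridgeItems.lean`,
`hodgeAbelianVarieties_of_cmAbelianHodge_of_cmToAbelian`, p139146; converse p141892), but that module imports
`Theses.PadicSemiregularLift` (through `…CMPivotSplit`), so the gate's `--glue-by` rendering of
`theorem …_holds … := _root_.<decl>` INTO the route file would close an import cycle (BC2-REDIRECT-r1 §3). This file is the
formula-level twin asked for there: it imports only `Theses.RankFourFaces` (which does NOT import `Theses.PadicSemiregularLift`)
and the smooth-projectivity theorem of abelian varieties, and concludes the crux's definiens
`∀ A : AbelianVariety ℂ, HodgeConjectureFor A.dim A.X` (to which `PadicSemiregularLift.HodgeAbelianVarieties` unfolds by `Iff.rfl`,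
`CMPivotAndre.hodgeAbelianVarieties_iff_formula` in the registered skeleton). Seam = modus ponens + the Literature theorem
`AbelianVariety.isSmoothProjective_holds` (Görtz–Wedhorn 27.174), verbatim the landed glue.
-/

set_option linter.dupNamespace false

noncomputable section

namespace Summit.HodgeConjecture.HodgeConjecture.Theorems.HodgeAbelianVarieties.CMPivotGlueFormula

open Literature.AlgebraicGeometry Literature.AlgebraicGeometry.Motives Literature.AlgebraicGeometry.HodgeTheory

/-- **CM-pivot glue, formula level.** HC for CM abelian varieties (`RankFourFaces.CMAbelianHodge`, stmt-3052) and the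
transport implication HC(CM) ⟹ HC(all abelian varieties) (`RankFourFaces.CMToAbelian`, stmt-16267) give the Hodge
conjecture for every complex abelian variety, stated as the FORMULA `∀ A : AbelianVariety ℂ, HodgeConjectureFor A.dim A.X`
(the definiens of `PadicSemiregularLift.HodgeAbelianVarieties`). The smooth-projectivity hypothesis of `CMToAbelian` is
discharged by `AbelianVariety.isSmoothProjective_holds`. Usable as `--glue-by` for the split of stmt-HodgeConjecture-1333
(no import of `Theses.PadicSemiregularLift`). [folklore] -/
theorem hodgeAbelianVarietiesFormula_of_cmAbelianHodge_of_cmToAbelian : Summit.HodgeConjecture.HodgeConjecture.Theses.RankFourFaces.CMAbelianHodge → Summit.HodgeConjecture.HodgeConjecture.Theses.RankFourFaces.CMToAbelian → ∀ A : Literature.AlgebraicGeometry.Motives.AbelianVariety ℂ, Literature.AlgebraicGeometry.HodgeTheory.HodgeConjectureFor A.dim A.X :=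
  fun h₁ h₂ A ↦ h₂ h₁ A (AbelianVariety.isSmoothProjective_holds (A := A))

/-- Converse bookkeeping (lossless split, formula level): the formula gives back both pieces — `CMAbelianHodge` by
restricting the binder and `CMToAbelian` by discarding its antecedent. [folklore] -/
theorem cmAbelianHodge_and_cmToAbelian_of_hodgeAbelianVarietiesFormula
    (h : ∀ A : AbelianVariety ℂ, HodgeConjectureFor A.dim A.X) :
    Theses.RankFourFaces.CMAbelianHodge ∧ Theses.RankFourFaces.CMToAbelian :=
  ⟨fun A _ _ ↦ h A, fun _ A _ ↦ h A⟩

/-- Hence the formula is EQUIVALENT to the conjunction of the two pieces (the split loses nothing). [folklore] -/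
theorem hodgeAbelianVarietiesFormula_iff_cmAbelianHodge_and_cmToAbelian :
    (∀ A : AbelianVariety ℂ, HodgeConjectureFor A.dim A.X) ↔
      (Theses.RankFourFaces.CMAbelianHodge ∧ Theses.RankFourFaces.CMToAbelian) :=
  ⟨cmAbelianHodge_and_cmToAbelian_of_hodgeAbelianVarietiesFormula,
    fun h ↦ hodgeAbelianVarietiesFormula_of_cmAbelianHodge_of_cmToAbelian h.1 h.2⟩

end Summit.HodgeConjecture.HodgeConjecture.Theorems.HodgeAbelianVarieties.CMPivotGlueFormula

end
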